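import Literature.MathematicalPhysics.QuantumFieldTheory.LatticeMaxwellBlockOU
import HarnessLib

/-!
# The `t`-derivative of the Gaussian interpolation `t ↦ E g(√t x + √(1−t) Z)` (Meckes 2009,
# proof of Lemma 1 (3))

Continuation of `LatticeMaxwellBlockOU.lean` (general layer `SteinOU`: a law `γ` on a real normed
space `E`, `gaussInterp γ g t x = E g(√t x + √(1−t) Z)`, `Z ∼ γ`). Meckes' proof of Stein's
equation (Lemma 1 (3)) starts from "`Z_{x,0} = Z_Σ`, `Z_{x,1} = x`" and differentiates the
interpolation in `t`; this file supplies that skeleton for `g ∈ C¹` with bounded derivative and a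
probability law `γ` with a first moment (no Gaussianity is used):

* `hasDerivAt_interp_path`, `hasDerivAt_comp_interp_path` — `d/dt (√t x + √(1−t) z) =
  x/(2√t) − z/(2√(1−t))` on `(0,1)` and the chain rule along it;
* `hasDerivAt_gaussInterp` — **`d/dt E g(Z_{x,t}) = E[Dg(Z_{x,t}) (x/(2√t) − Z/(2√(1−t)))]`** for
  `0 < t < 1` (differentiation under the expectation, locally dominated);
* `continuousOn_gaussInterp_Icc` — continuity of `t ↦ E g(Z_{x,t})` on `[0,1]`;
* `integrableOn_deriv_gaussInterp` — the derivative is dominated by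
  `(C‖x‖/2) t^{-1/2} + (C E‖Z‖/2)(1−t)^{-1/2}`, integrable on `(0,1)`;
* `sub_integral_eq_integral_deriv_gaussInterp` — the fundamental theorem of calculus:
  `g(x) − E g(Z) = ∫₀¹ E[Dg(Z_{x,t}) (x/(2√t) − Z/(2√(1−t)))] dt`.

Gaussian integration by parts turns the integrand into `−(2t)⁻¹ (L E g(Z_{·,t}))(x)` for the
Ornstein–Uhlenbeck generator `L`; that step and Stein's equation are in
`LatticeMaxwellBlockSteinEquation.lean`.

References: E. Meckes, *On Stein's method for multivariate normal approximation*, IMS Collections 5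
(2009) 153–178, arXiv:0902.0333, proof of Lemma 1 (3) [Meckes2009]; S. Chatterjee, E. Meckes,
ALEA 4 (2008) 257–283, arXiv:math/0701464, proof of Lemma 2 [ChatterjeeMeckes2007].
-/

noncomputable section

open MeasureTheory ProbabilityTheory Filter Set
open scoped Topology

namespace Literature.MathematicalPhysics.QuantumFieldTheory

namespace SteinOU

variable {E : Type*} [NormedAddCommGroup E] [NormedSpace ℝ E] [MeasurableSpace E] [BorelSpace E]
  [SecondCountableTopology E] {γ : Measure E} [IsProbabilityMeasure γ] {g : E → ℝ} {C : ℝ}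

omit [MeasurableSpace E] [BorelSpace E] [SecondCountableTopology E] in
/-- `|Dg(y)[v]| ≤ M₁(g) ‖v‖`. [folklore] -/
private theorem abs_fderiv_apply_le' (hC : ∀ x, ‖fderiv ℝ g x‖ ≤ C) (y v : E) :
    |fderiv ℝ g y v| ≤ C * ‖v‖ := by
  rw [← Real.norm_eq_abs]
  exact (ContinuousLinearMap.le_opNorm _ _).trans
    (mul_le_mul_of_nonneg_right (hC y) (norm_nonneg _))

/-! ### The interpolation path and its `t`-derivative -/

omit [MeasurableSpace E] [BorelSpace E] [SecondCountableTopology E] in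
/-- A `C¹` function with `‖Dg‖ ≤ C` is `C`-Lipschitz: "`M₁(f) = sup ‖Df‖_op` is the Lipschitz
constant of `f`". [cite: Meckes2009, §1 (the quantities M_k(f))] -/
theorem lipschitzWith_of_norm_fderiv_le (hg : ContDiff ℝ 1 g) (hC : ∀ x, ‖fderiv ℝ g x‖ ≤ C) :
    LipschitzWith C.toNNReal g := by
  refine lipschitzWith_of_nnnorm_fderiv_le (hg.differentiable one_ne_zero) fun x => ?_
  rw [← NNReal.coe_le_coe, coe_nnnorm]
  exact (hC x).trans (Real.le_coe_toNNReal C)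

omit [MeasurableSpace E] [BorelSpace E] [SecondCountableTopology E] in
/-- The `t`-derivative of the interpolation path: `d/dt (√t x + √(1−t) z) = x/(2√t) − z/(2√(1−t))`
for `0 < t < 1`. [cite: Meckes2009, proof of Lemma 1 (3)] -/
theorem hasDerivAt_interp_path (x z : E) {t : ℝ} (ht0 : 0 < t) (ht1 : t < 1) :
    HasDerivAt (fun t : ℝ => Real.sqrt t • x + Real.sqrt (1 - t) • z)
      ((1 / (2 * Real.sqrt t)) • x - (1 / (2 * Real.sqrt (1 - t))) • z) t := by
  have h1 : HasDerivAt (fun t : ℝ => Real.sqrt t) (1 / (2 * Real.sqrt t)) t :=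
    Real.hasDerivAt_sqrt ht0.ne'
  have h2 : HasDerivAt (fun t : ℝ => Real.sqrt (1 - t)) (-(1 / (2 * Real.sqrt (1 - t)))) t := by
    have h := (Real.hasDerivAt_sqrt (x := 1 - t) (by linarith)).comp t
      ((hasDerivAt_id t).const_sub 1)
    have e : (fun t : ℝ => Real.sqrt (1 - t)) = Real.sqrt ∘ fun x : ℝ => 1 - id x := by
      funext s; simp
    rw [e]
    simpa using h
  have h := (h1.smul_const x).fun_add (h2.smul_const z)
  simpa [sub_eq_add_neg, neg_smul] using h

omit [MeasurableSpace E] [BorelSpace E] [SecondCountableTopology E] in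
/-- Chain rule along the interpolation path:
`d/dt g(√t x + √(1−t) z) = Dg(Z_{x,t})[x/(2√t) − z/(2√(1−t))]`. [cite: Meckes2009, proof of Lemma 1 (3)] -/
theorem hasDerivAt_comp_interp_path (hg : ContDiff ℝ 1 g) (x z : E) {t : ℝ} (ht0 : 0 < t)
    (ht1 : t < 1) :
    HasDerivAt (fun t : ℝ => g (Real.sqrt t • x + Real.sqrt (1 - t) • z))
      (fderiv ℝ g (Real.sqrt t • x + Real.sqrt (1 - t) • z)
        ((1 / (2 * Real.sqrt t)) • x - (1 / (2 * Real.sqrt (1 - t))) • z)) t :=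
  ((hg.differentiable one_ne_zero) _).hasFDerivAt.comp_hasDerivAt t
    (hasDerivAt_interp_path x z ht0 ht1)

omit [MeasurableSpace E] [BorelSpace E] [SecondCountableTopology E] in
/-- Bound on the `t`-derivative integrand: `|Dg(Z_{x,t})[x/(2√t) − z/(2√(1−t))]| ≤
C (‖x‖/(2√t) + ‖z‖/(2√(1−t)))`. [cite: Meckes2009, proof of Lemma 1 (3)] -/
theorem abs_fderiv_interp_path_le (hC : ∀ x, ‖fderiv ℝ g x‖ ≤ C) (x z : E) {t : ℝ}
    (ht0 : 0 < t) (ht1 : t < 1) :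
    |fderiv ℝ g (Real.sqrt t • x + Real.sqrt (1 - t) • z)
        ((1 / (2 * Real.sqrt t)) • x - (1 / (2 * Real.sqrt (1 - t))) • z)| ≤
      C * (1 / (2 * Real.sqrt t) * ‖x‖ + 1 / (2 * Real.sqrt (1 - t)) * ‖z‖) := by
  have hC0 : 0 ≤ C := (norm_nonneg _).trans (hC 0)
  have hs0 : 0 < Real.sqrt t := Real.sqrt_pos.2 ht0
  have hs1 : 0 < Real.sqrt (1 - t) := Real.sqrt_pos.2 (by linarith)
  refine (abs_fderiv_apply_le' hC _ _).trans (mul_le_mul_of_nonneg_left ?_ hC0)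
  calc ‖(1 / (2 * Real.sqrt t)) • x - (1 / (2 * Real.sqrt (1 - t))) • z‖
      ≤ ‖(1 / (2 * Real.sqrt t)) • x‖ + ‖(1 / (2 * Real.sqrt (1 - t))) • z‖ := norm_sub_le _ _
    _ = 1 / (2 * Real.sqrt t) * ‖x‖ + 1 / (2 * Real.sqrt (1 - t)) * ‖z‖ := by
        rw [norm_smul, norm_smul, Real.norm_of_nonneg (by positivity),
          Real.norm_of_nonneg (by positivity)]

omit [SecondCountableTopology E] in
/-- **The `t`-derivative of the Gaussian interpolation** (Meckes 2009, proof of Lemma 1 (3)): for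
`g ∈ C¹` with bounded derivative, a probability law `γ` with a first moment and `0 < t < 1`,
`d/dt E g(Z_{x,t}) = E[Dg(Z_{x,t}) (x/(2√t) − Z/(2√(1−t)))]` — differentiation under the
expectation, dominated on a neighbourhood of `t` by `C(‖x‖/(2√(t/2)) + ‖Z‖/(2√((1−t)/2)))`.
[cite: Meckes2009, proof of Lemma 1 (3)] -/
theorem hasDerivAt_gaussInterp (hg : ContDiff ℝ 1 g) (hC : ∀ x, ‖fderiv ℝ g x‖ ≤ C)
    (hγ : Integrable (fun z : E => ‖z‖) γ) (x : E) {t₀ : ℝ} (ht₀ : t₀ ∈ Set.Ioo (0 : ℝ) 1) :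
    HasDerivAt (fun t => gaussInterp γ g t x)
      (∫ z, fderiv ℝ g (Real.sqrt t₀ • x + Real.sqrt (1 - t₀) • z)
        ((1 / (2 * Real.sqrt t₀)) • x - (1 / (2 * Real.sqrt (1 - t₀))) • z) ∂γ) t₀ := by
  obtain ⟨h0, h1⟩ := ht₀
  have hgL := lipschitzWith_of_norm_fderiv_le hg hC
  have hC0 : 0 ≤ C := (norm_nonneg _).trans (hC 0)
  have hDc : Continuous (fderiv ℝ g) := hg.continuous_fderiv one_ne_zero
  -- the neighbourhood `(t₀/2, (1+t₀)/2)` of `t₀`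
  set s : Set ℝ := Set.Ioo (t₀ / 2) ((1 + t₀) / 2) with hs_def
  have hs : s ∈ 𝓝 t₀ := Ioo_mem_nhds (by linarith) (by linarith)
  have hs_sub : ∀ t ∈ s, 0 < t ∧ t < 1 := fun t ht => ⟨by linarith [ht.1], by linarith [ht.2]⟩
  set a : ℝ := 1 / (2 * Real.sqrt (t₀ / 2)) with ha
  set b : ℝ := 1 / (2 * Real.sqrt ((1 - t₀) / 2)) with hb
  have hsa : 0 < Real.sqrt (t₀ / 2) := Real.sqrt_pos.2 (by linarith)
  have hsb : 0 < Real.sqrt ((1 - t₀) / 2) := Real.sqrt_pos.2 (by linarith)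
  have hcoef : ∀ t ∈ s, 1 / (2 * Real.sqrt t) ≤ a ∧ 1 / (2 * Real.sqrt (1 - t)) ≤ b := by
    intro t ht
    obtain ⟨ht0, ht1⟩ := hs_sub t ht
    constructor
    · rw [ha]
      refine one_div_le_one_div_of_le (by positivity) ?_
      exact mul_le_mul_of_nonneg_left (Real.sqrt_le_sqrt (by linarith [ht.1])) (by norm_num)
    · rw [hb]
      refine one_div_le_one_div_of_le (by positivity) ?_
      exact mul_le_mul_of_nonneg_left (Real.sqrt_le_sqrt (by linarith [ht.2])) (by norm_num)
  have h := hasDerivAt_integral_of_dominated_loc_of_deriv_le (μ := γ) (x₀ := t₀) (s := s)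
    (F := fun t z => g (Real.sqrt t • x + Real.sqrt (1 - t) • z))
    (F' := fun t z => fderiv ℝ g (Real.sqrt t • x + Real.sqrt (1 - t) • z)
      ((1 / (2 * Real.sqrt t)) • x - (1 / (2 * Real.sqrt (1 - t))) • z))
    (bound := fun z => C * (a * ‖x‖ + b * ‖z‖)) hs ?_ ?_ ?_ ?_ ?_ ?_
  · exact h.2
  · exact Eventually.of_forall fun t => (integrable_comp_interp hgL hγ t x).aestronglyMeasurable
  · exact integrable_comp_interp hgL hγ t₀ x
  · refine Continuous.aestronglyMeasurable ?_
    exact (hDc.comp (by fun_prop)).clm_apply (by fun_prop)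
  · refine Eventually.of_forall fun z t ht => ?_
    obtain ⟨ht0, ht1⟩ := hs_sub t ht
    rw [Real.norm_eq_abs]
    refine (abs_fderiv_interp_path_le hC x z ht0 ht1).trans (mul_le_mul_of_nonneg_left ?_ hC0)
    obtain ⟨h₁, h₂⟩ := hcoef t ht
    gcongr
  · exact ((integrable_const (a * ‖x‖)).add (hγ.const_mul b)).const_mul C
  · exact Eventually.of_forall fun z t ht =>
      hasDerivAt_comp_interp_path hg x z (hs_sub t ht).1 (hs_sub t ht).2

omit [SecondCountableTopology E] in
/-- **Continuity of the interpolation in `t` on `[0, 1]`**: `t ↦ E g(√t x + √(1−t) Z)` is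
continuous on `[0,1]` for Lipschitz `g` and `γ` with a first moment (dominated by
`|g 0| + L(‖x‖ + ‖Z‖)`). [cite: Meckes2009, proof of Lemma 1 (3)] -/
theorem continuousOn_gaussInterp_Icc {L : NNReal} (hg : LipschitzWith L g)
    (hγ : Integrable (fun z : E => ‖z‖) γ) (x : E) :
    ContinuousOn (fun t => gaussInterp γ g t x) (Set.Icc (0 : ℝ) 1) := by
  have hL : (0 : ℝ) ≤ L := L.coe_nonneg
  refine continuousOn_of_dominated (μ := γ)
    (F := fun t z => g (Real.sqrt t • x + Real.sqrt (1 - t) • z))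
    (bound := fun z => |g 0| + L * (‖x‖ + ‖z‖)) ?_ ?_ ?_ ?_
  · exact fun t _ => (integrable_comp_interp hg hγ t x).aestronglyMeasurable
  · intro t ht
    refine Eventually.of_forall fun z => ?_
    obtain ⟨ht0, ht1⟩ := ht
    have hs0 : Real.sqrt t ≤ 1 := Real.sqrt_le_one.mpr ht1 |>.trans_eq' rfl
    have hs1 : Real.sqrt (1 - t) ≤ 1 := (Real.sqrt_le_one (x := 1 - t)).mpr (by linarith)
    have hd := hg.dist_le_mul (Real.sqrt t • x + Real.sqrt (1 - t) • z) 0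
    rw [Real.dist_eq, dist_zero_right] at hd
    have hn : ‖Real.sqrt t • x + Real.sqrt (1 - t) • z‖ ≤ ‖x‖ + ‖z‖ := by
      calc ‖Real.sqrt t • x + Real.sqrt (1 - t) • z‖
          ≤ ‖Real.sqrt t • x‖ + ‖Real.sqrt (1 - t) • z‖ := norm_add_le _ _
        _ = Real.sqrt t * ‖x‖ + Real.sqrt (1 - t) * ‖z‖ := by
            rw [norm_smul, norm_smul, Real.norm_of_nonneg (Real.sqrt_nonneg _),
              Real.norm_of_nonneg (Real.sqrt_nonneg _)]
        _ ≤ 1 * ‖x‖ + 1 * ‖z‖ := by gcongr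
        _ = ‖x‖ + ‖z‖ := by ring
    rw [Real.norm_eq_abs]
    have h3 : |g (Real.sqrt t • x + Real.sqrt (1 - t) • z)| ≤
        |g (Real.sqrt t • x + Real.sqrt (1 - t) • z) - g 0| + |g 0| := by
      have := abs_add_le (g (Real.sqrt t • x + Real.sqrt (1 - t) • z) - g 0) (g 0)
      simpa using this
    nlinarith [mul_le_mul_of_nonneg_left hn hL]
  · exact (integrable_const |g 0|).add (((integrable_const ‖x‖).add hγ).const_mul (L : ℝ))
  · refine Eventually.of_forall fun z => Continuous.continuousOn ?_
    exact hg.continuous.comp (by fun_prop)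

/-- The `t`-derivative of the interpolation is integrable on `(0, 1)`: it is dominated by
`(C‖x‖/2) t^{-1/2} + (C E‖Z‖/2) (1−t)^{-1/2}`. [cite: Meckes2009, proof of Lemma 1 (3)] -/
theorem integrableOn_deriv_gaussInterp (hg : ContDiff ℝ 1 g) (hC : ∀ x, ‖fderiv ℝ g x‖ ≤ C)
    (hγ : Integrable (fun z : E => ‖z‖) γ) (x : E) :
    IntegrableOn (fun t : ℝ => ∫ z, fderiv ℝ g (Real.sqrt t • x + Real.sqrt (1 - t) • z)
        ((1 / (2 * Real.sqrt t)) • x - (1 / (2 * Real.sqrt (1 - t))) • z) ∂γ)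
      (Set.Ioo (0 : ℝ) 1) := by
  have hC0 : 0 ≤ C := (norm_nonneg _).trans (hC 0)
  have hDc : Continuous (fderiv ℝ g) := hg.continuous_fderiv one_ne_zero
  set m : ℝ := ∫ z, ‖z‖ ∂γ with hm
  have hm0 : 0 ≤ m := integral_nonneg fun z => norm_nonneg z
  -- measurability in `t`, through joint measurability of the expanded integrand
  have hmeas : StronglyMeasurable fun t : ℝ => ∫ z, fderiv ℝ g (Real.sqrt t • x + Real.sqrt (1 - t) • z)
      ((1 / (2 * Real.sqrt t)) • x - (1 / (2 * Real.sqrt (1 - t))) • z) ∂γ := by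
    refine StronglyMeasurable.integral_prod_right' (ν := γ)
      (f := fun p : ℝ × E => fderiv ℝ g (Real.sqrt p.1 • x + Real.sqrt (1 - p.1) • p.2)
        ((1 / (2 * Real.sqrt p.1)) • x - (1 / (2 * Real.sqrt (1 - p.1))) • p.2))
      (Measurable.stronglyMeasurable ?_)
    have hpath : Continuous fun p : ℝ × E => Real.sqrt p.1 • x + Real.sqrt (1 - p.1) • p.2 := by
      fun_prop
    have hK₁ : Measurable fun p : ℝ × E =>
        fderiv ℝ g (Real.sqrt p.1 • x + Real.sqrt (1 - p.1) • p.2) x :=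
      ((hDc.comp hpath).clm_apply continuous_const).measurable
    have hK₂ : Measurable fun p : ℝ × E =>
        fderiv ℝ g (Real.sqrt p.1 • x + Real.sqrt (1 - p.1) • p.2) p.2 :=
      ((hDc.comp hpath).clm_apply continuous_snd).measurable
    have hc₁ : Measurable fun p : ℝ × E => 1 / (2 * Real.sqrt p.1) :=
      (measurable_const.mul (Real.continuous_sqrt.measurable.comp measurable_fst)).const_div 1
    have hc₂ : Measurable fun p : ℝ × E => 1 / (2 * Real.sqrt (1 - p.1)) :=
      (measurable_const.mul (Real.continuous_sqrt.measurable.comp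
        (measurable_const.sub measurable_fst))).const_div 1
    convert ((hc₁.mul hK₁).sub (hc₂.mul hK₂)) using 1
    funext p
    simp only [Pi.sub_apply, Pi.mul_apply, map_sub, map_smul, smul_eq_mul]
  -- the dominating function
  have hrpow : IntegrableOn (fun t : ℝ => t ^ (-(1 / 2 : ℝ))) (Set.Ioo (0 : ℝ) 1) := by
    have h := intervalIntegral.intervalIntegrable_rpow' (a := (0 : ℝ)) (b := 1)
      (r := -(1 / 2 : ℝ)) (by norm_num)
    rwa [intervalIntegrable_iff_integrableOn_Ioo_of_le zero_le_one] at h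
  have hrpow' : IntegrableOn (fun t : ℝ => (1 - t) ^ (-(1 / 2 : ℝ))) (Set.Ioo (0 : ℝ) 1) := by
    have h := (intervalIntegral.intervalIntegrable_rpow' (a := (1 : ℝ)) (b := 0)
      (r := -(1 / 2 : ℝ)) (by norm_num)).comp_sub_left 1
    rw [sub_self, sub_zero] at h
    rwa [intervalIntegrable_iff_integrableOn_Ioo_of_le zero_le_one] at h
  have hbound : IntegrableOn
      (fun t : ℝ => C * ‖x‖ / 2 * t ^ (-(1 / 2 : ℝ)) + C * m / 2 * (1 - t) ^ (-(1 / 2 : ℝ)))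
      (Set.Ioo (0 : ℝ) 1) :=
    (hrpow.const_mul _).add (hrpow'.const_mul _)
  refine Integrable.mono' hbound hmeas.aestronglyMeasurable ?_
  rw [ae_restrict_iff' measurableSet_Ioo]
  refine Eventually.of_forall fun t ht => ?_
  obtain ⟨ht0, ht1⟩ := ht
  have hs0 : 0 < Real.sqrt t := Real.sqrt_pos.2 ht0
  have hs1 : 0 < Real.sqrt (1 - t) := Real.sqrt_pos.2 (by linarith)
  have hint : Integrable (fun z : E => C * (1 / (2 * Real.sqrt t) * ‖x‖ +
      1 / (2 * Real.sqrt (1 - t)) * ‖z‖)) γ :=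
    ((integrable_const _).add (hγ.const_mul _)).const_mul C
  have h := norm_integral_le_of_norm_le hint (Eventually.of_forall fun z => by
    rw [Real.norm_eq_abs]; exact abs_fderiv_interp_path_le hC x z ht0 ht1)
  refine h.trans (le_of_eq ?_)
  rw [integral_const_mul, integral_add (integrable_const _) (hγ.const_mul _), integral_const,
    integral_const_mul, ← hm]
  simp only [probReal_univ, smul_eq_mul, one_mul]
  have e1 : 1 / (2 * Real.sqrt t) = (1 / 2) * t ^ (-(1 / 2 : ℝ)) := by
    rw [Real.sqrt_eq_rpow, Real.rpow_neg ht0.le]; field_simp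
  have e2 : 1 / (2 * Real.sqrt (1 - t)) = (1 / 2) * (1 - t) ^ (-(1 / 2 : ℝ)) := by
    rw [Real.sqrt_eq_rpow, Real.rpow_neg (by linarith)]; field_simp
  rw [e1, e2]; ring

/-- **Fundamental theorem of calculus for the interpolation** (the skeleton of Meckes' proof of
Lemma 1 (3): "`Z_{x,0} = Z_Σ` and `Z_{x,1} = x`", integrate `d/dt E g(Z_{x,t})` over `(0,1)`): for
`g ∈ C¹` with bounded derivative and a probability law `γ` with a first moment,
`g(x) − E g(Z) = ∫₀¹ E[Dg(Z_{x,t}) (x/(2√t) − Z/(2√(1−t)))] dt`. [cite: Meckes2009, proof of Lemma 1 (3)] -/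
theorem sub_integral_eq_integral_deriv_gaussInterp (hg : ContDiff ℝ 1 g)
    (hC : ∀ x, ‖fderiv ℝ g x‖ ≤ C) (hγ : Integrable (fun z : E => ‖z‖) γ) (x : E) :
    g x - ∫ z, g z ∂γ =
      ∫ t in Set.Ioo (0 : ℝ) 1, ∫ z, fderiv ℝ g (Real.sqrt t • x + Real.sqrt (1 - t) • z)
        ((1 / (2 * Real.sqrt t)) • x - (1 / (2 * Real.sqrt (1 - t))) • z) ∂γ := by
  have hgL := lipschitzWith_of_norm_fderiv_le hg hC
  have hint := integrableOn_deriv_gaussInterp hg hC hγ x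
  rw [← gaussInterp_one γ g x, ← gaussInterp_zero γ g x,
    ← intervalIntegral.integral_eq_sub_of_hasDerivAt_of_le zero_le_one
      (continuousOn_gaussInterp_Icc hgL hγ x)
      (fun t ht => hasDerivAt_gaussInterp hg hC hγ x ht)
      ((intervalIntegrable_iff_integrableOn_Ioo_of_le zero_le_one).2 hint),
    intervalIntegral.integral_of_le zero_le_one, integral_Ioc_eq_integral_Ioo]


end SteinOU

end Literature.MathematicalPhysics.QuantumFieldTheory

end
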